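import Literature.NumberTheory.EllipticCurves.SelmerCorankIsogenyProofs
import Literature.NumberTheory.EllipticCurves.IwasawaLeadingTermProofs
import Literature.NumberTheory.EllipticCurves.ZpCorankLevelProfile
import Literature.NumberTheory.EllipticCurves.ShaPTorsionQuadraticSplitting
import Literature.NumberTheory.EllipticCurves.IsogenyTwoTorsionProofs
import Literature.NumberTheory.EllipticCurves.XCubeSub8XSqAddXRankZero
import Literature.NumberTheory.EllipticCurves.TwoIsogenyShaTwoTorsionExamples
import Literature.NumberTheory.EllipticCurves.Curve8x121IsogenyRank
import Literature.NumberTheory.EllipticCurves.Curve8x121SharpDescentY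
import Literature.NumberTheory.EllipticCurves.Curve8x121ShaTwoTorsion
import Literature.NumberTheory.EllipticCurves.Curve346IsogenyRank
import Literature.NumberTheory.EllipticCurves.Curve346SharpDescentY
import Literature.NumberTheory.EllipticCurves.Curve388IsogenyRank
import Literature.NumberTheory.EllipticCurves.Curve388SharpDescentY
import Literature.NumberTheory.EllipticCurves.Curve388ShaTwoTorsion
import HarnessLib

/-!
# An isogeny onto a curve with `Ш[p] = 0` kills `Ш[p^∞]` by its degree; the COMPLETE `2`-primary
# components `Ш(X/ℚ)[2^∞] ≅ (ℤ/2ℤ)²` of the isogeny-door carriers `X₈`, `X₁₂₁`, `X₃₄₆`, `X₃₈₈`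

Topic `Literature/NumberTheory/EllipticCurves`, family `bsd`. Theorems only (no definition, no named
fact; D-0026).

* §1 (algebra) `primaryComponent_eq_bot_of_torsionBy_eq_bot` (a group without `p`-torsion has trivial
  `p`-primary component), `sha_torsionBy_eq_bot_of_forall` (the tree's descent currency
  «`∀ c ∈ Ш, p • c = 0 → c = 0`» as `Ш[p] = ⊥`), `sha_torsionBy_eq_bot_of_smul_eq` (transport along a
  change of variables), and `nonempty_addEquiv_prod_zmod_of_natCard_eq_sq` (**an abelian group killed
  by `p` of order `p²` is `ℤ/p × ℤ/p`**).
* §2 **THE ISOGENY KILL** (Milne, *ADT*, proof of Lemma I.7.1(b): `Ш(φ̂) ∘ Ш(φ) = deg φ`, tree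
  `ker_shaMap_le_torsionBy`). For an isogeny `φ : E → E'` of elliptic curves over a number field:
  if `Ш(E'/K)[p^∞] = 0` then `Ш(E/K)[p^∞] ⊆ ker Ш(φ) ⊆ Ш(E/K)[deg φ]`
  (`Isogeny.primaryComponent_sha_le_torsionBy_degree`); so **if `deg φ = p` and `Ш(E'/K)[p] = 0` then
  `Ш(E/K)[p^∞] = Ш(E/K)[p]`** (`Isogeny.primaryComponent_sha_eq_torsionBy_of_degree_eq`): the whole
  `p`-primary component is killed by `p`, is finite, `t_p(E) = 0`, and `#Ш(E/K)[p^e] = #Ш(E/K)[p]` for every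
  `e ≥ 1` — a sharp `p`-descent on the `p`-isogenous curve determines the `p`-primary component of
  `Ш(E)` COMPLETELY, with no second descent on `E`.
* §3 **The complete `2`-primary components of the four isogeny-door carriers** of the tree
  (`XCubeSub8XSqAddX*`, `Curve8x121*`, `Curve346*`, `Curve388*`, `TwoIsogenyShaTwoTorsionExamples`: each
  `X` has a `2`-isogeny `X → X' ≅ Y` with `Ш(Y/ℚ)[2] = 0` by a sharp first descent, and `#Ш(X/ℚ)[2] = 4`):
  **`Ш(X/ℚ)[2^∞] = Ш(X/ℚ)[2] ≅ ℤ/2ℤ × ℤ/2ℤ`** and `#Ш(X/ℚ)[2^e] = 4` for all `e ≥ 1`, for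
  `X₈ = [0,−8,0,1,0]` (rank `0`), `X₁₂₁ = [0,8,0,121,0]` (rank `1`), `X₃₄₆ = [0,−346,0,1369,0]` and
  `X₃₈₈ = [0,−388,0,676,0]` (rank `2`). Previously the tree knew `t_2(X) = 0` and `#Ш(X)[2] = 4`, i.e.
  `Ш(X)[2^∞] ≅ (ℤ/2^a)²` for some `a ≥ 1`; the kill gives `a = 1`.

## References

* J. S. Milne, *Arithmetic Duality Theorems*, 2nd ed. (2006), Ch. I, Lemma 7.1(b) and its proof
  (p. 96). [MilneADT2006]
* J. H. Silverman, *The Arithmetic of Elliptic Curves*, 2nd ed. (2009), III.4.5, III.6.1–2, X.4.2,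
  Prop. X.6.5(b). [SilvermanAEC2009]
* R. Greenberg, LNM 1716 (1999), §1, pp. 54–57. [Greenberg1999LNM]
* S. Lang, *Algebra*, rev. 3rd ed. (2002), Ch. III §5–§6 (vector spaces over a field; dimension).
  [Lang2002]
-/

noncomputable section

open scoped Classical
open scoped AddSubgroup
open Literature.NumberTheory.EllipticCurves Literature.Algebra.Module

universe u

/-! ### §1 Algebra -/

namespace Literature.NumberTheory.EllipticCurves

/-- **A group without `p`-torsion has trivial `p`-primary component**: `X[p] = ⊥ ⟹ X[p^∞] = ⊥`.
[cite: Fuchs1970, Ch. I §1 (the subgroups `A[n]`; `p`-groups)] -/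
theorem primaryComponent_eq_bot_of_torsionBy_eq_bot {X : Type*} [AddCommGroup X] (p : ℕ)
    (h : X[(p : ℤ)] = ⊥) : AddCommGroup.primaryComponent X p = ⊥ := by
  have key : ∀ k : ℕ, ∀ x : X, p ^ k • x = 0 → x = 0 := by
    intro k
    induction k with
    | zero => intro x hx; rwa [pow_zero, one_smul] at hx
    | succ k ih =>
      intro x hx
      rw [pow_succ', mul_smul] at hx
      have hmem : p ^ k • x ∈ X[(p : ℤ)] := AddSubgroup.torsionBy.nsmul_iff.mpr hx
      rw [h, AddSubgroup.mem_bot] at hmem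
      exact ih x hmem
  refine (AddSubgroup.eq_bot_iff_forall _).mpr fun x hx ↦ ?_
  obtain ⟨k, hk⟩ := (AddCommGroup.mem_primaryComponent).mp hx
  exact key k x hk

/-- **An abelian group killed by a prime `p` and of order `p²` is `ℤ/p × ℤ/p`** (a `2`-dimensional
`𝔽_p`-vector space; Lang, *Algebra*, III §5). [cite: Lang2002, Ch. III §5 (bases and dimension of vector spaces)] -/
theorem nonempty_addEquiv_prod_zmod_of_natCard_eq_sq {G : Type*} [AddCommGroup G] (p : ℕ)
    [hp : Fact p.Prime] (hG : ∀ g : G, p • g = 0) (hcard : Nat.card G = p ^ 2) :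
    Nonempty (G ≃+ ZMod p × ZMod p) := by
  haveI : Module (ZMod p) G := AddCommGroup.zmodModule hG
  haveI : Finite G := Nat.finite_of_card_ne_zero (by rw [hcard]; exact pow_ne_zero 2 hp.out.ne_zero)
  haveI : Module.Finite (ZMod p) G := Module.Finite.of_finite
  have hdim : Module.finrank (ZMod p) G = 2 :=
    Nat.pow_right_injective hp.out.two_le ((pow_finrank_eq_natCard (p := p) G).trans hcard)
  have hdim' : Module.finrank (ZMod p) (ZMod p × ZMod p) = 2 := by
    rw [Module.finrank_prod, Module.finrank_self]
  exact ⟨(LinearEquiv.ofFinrankEq (R := ZMod p) G (ZMod p × ZMod p) (hdim.trans hdim'.symm)).toAddEquiv⟩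

end Literature.NumberTheory.EllipticCurves

namespace WeierstrassCurve

variable {K : Type u} [Field K] [NumberField K]

/-- **`Ш[p] = ⊥` from the descent currency** «every class of `Ш(E/K)` killed by `p` is zero».
[cite: SilvermanAEC2009, Thm. X.4.2(a)] -/
theorem sha_torsionBy_eq_bot_of_forall (W : WeierstrassCurve K) (p : ℕ)
    (h : ∀ c ∈ W.sha, p • c = 0 → c = 0) : W.sha[(p : ℤ)] = ⊥ := by
  refine (AddSubgroup.eq_bot_iff_forall _).mpr fun x hx ↦ Subtype.ext ?_
  have hx' : p • (x : W.galH1) = 0 := by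
    rw [← AddSubgroupClass.coe_nsmul, AddSubgroup.torsionBy.nsmul_iff.mp hx, ZeroMemClass.coe_zero]
  exact h _ x.2 hx'

/-- **`Ш[p] = ⊥` is transported along a change of variables**: if `C • W' = Y` and `Ш(Y/K)[p] = ⊥` then
`Ш(W'/K)[p] = ⊥` (`#Ш(C • W')[n] = #Ш(W')[n]`, tree `natCard_sha_torsionBy_variableChange`).
[cite: SilvermanAEC2009, X.§4 (with III.3.1(b))] -/
theorem sha_torsionBy_eq_bot_of_smul_eq {W' Y : WeierstrassCurve K} {C : VariableChange K}
    (hC : C • W' = Y) (p : ℕ) (hY : Y.sha[(p : ℤ)] = ⊥) :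
    W'.sha[(p : ℤ)] = ⊥ := by
  subst hC
  have h1 : Nat.card ((C • W').sha[(p : ℤ)]) = 1 := by rw [hY]; exact AddSubgroup.card_bot
  rw [natCard_sha_torsionBy_variableChange W' C p] at h1
  haveI : Finite (W'.sha[(p : ℤ)]) := Nat.finite_of_card_ne_zero (by rw [h1]; exact one_ne_zero)
  exact AddSubgroup.eq_bot_of_card_eq _ h1

namespace Isogeny

variable {W W' : WeierstrassCurve K} [W.IsElliptic] [W'.IsElliptic]

/-! ### §2 The isogeny kill -/

omit [W.IsElliptic] [W'.IsElliptic] in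
/-- **`Ш(E/K)[p^∞] ⊆ ker Ш(φ)` when `Ш(E'/K)[p^∞] = 0`**: `Ш(φ)` maps the `p`-primary component into the
`p`-primary component. [cite: MilneADT2006, Ch. I Lemma 7.1(b) (proof), p. 96] -/
theorem primaryComponent_sha_le_ker_shaMap (φ : Isogeny W W') (p : ℕ)
    (h' : AddCommGroup.primaryComponent W'.sha p = ⊥) :
    AddCommGroup.primaryComponent W.sha p ≤
      (shaMap φ.toAddMonoidHom φ.equivariant φ.hasLocalPointsMaps_toAddMonoidHom).ker := by
  intro c hc
  obtain ⟨k, hk⟩ := (AddCommGroup.mem_primaryComponent).mp hc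
  rw [AddMonoidHom.mem_ker, ← AddSubgroup.mem_bot, ← h']
  exact (AddCommGroup.mem_primaryComponent).mpr ⟨k, by rw [← map_nsmul, hk, map_zero]⟩

/-- **THE ISOGENY KILL.** For an isogeny `φ : E → E'` of elliptic curves over a number field and a prime
`p`: if `Ш(E'/K)[p^∞] = 0` then **`Ш(E/K)[p^∞] ⊆ Ш(E/K)[deg φ]`** (`Ш(E)[p^∞] ⊆ ker Ш(φ) ⊆ Ш(E)[deg φ]`
since `Ш(φ̂) ∘ Ш(φ) = deg φ`). [cite: MilneADT2006, Ch. I Lemma 7.1(b) (proof), p. 96]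
[cite: SilvermanAEC2009, Thm. III.6.1(a)] -/
theorem primaryComponent_sha_le_torsionBy_degree (φ : Isogeny W W') (p : ℕ)
    (h' : AddCommGroup.primaryComponent W'.sha p = ⊥) :
    AddCommGroup.primaryComponent W.sha p ≤ W.sha[(φ.degree : ℤ)] := by
  obtain ⟨ψ, hψ⟩ := φ.exists_dual_of_isElliptic
  exact (primaryComponent_sha_le_ker_shaMap φ p h').trans
    (ker_shaMap_le_torsionBy φ.toAddMonoidHom φ.equivariant φ.hasLocalPointsMaps_toAddMonoidHom
      ψ.toAddMonoidHom ψ.equivariant hψ)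

/-- **A `p`-isogeny onto a curve with `Ш[p] = 0` makes `Ш[p^∞] = Ш[p]`**: if `deg φ = p` and
`Ш(E'/K)[p] = 0` then `Ш(E/K)[p^∞] = Ш(E/K)[p]` — the complete `p`-primary component of `Ш(E/K)` is its
`p`-torsion. [cite: MilneADT2006, Ch. I Lemma 7.1(b) (proof), p. 96] [cite: SilvermanAEC2009, Thm. III.6.1(a)] -/
theorem primaryComponent_sha_eq_torsionBy_of_degree_eq (φ : Isogeny W W') (p : ℕ) (hdeg : φ.degree = p)
    (h' : W'.sha[(p : ℤ)] = ⊥) : AddCommGroup.primaryComponent W.sha p = W.sha[(p : ℤ)] := by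
  refine le_antisymm ?_ fun x hx ↦
    (AddCommGroup.mem_primaryComponent).mpr ⟨1, by rw [pow_one]; exact AddSubgroup.torsionBy.nsmul_iff.mp hx⟩
  have h := primaryComponent_sha_le_torsionBy_degree φ p (primaryComponent_eq_bot_of_torsionBy_eq_bot p h')
  rwa [hdeg] at h

/-- Under the same hypotheses **`t_p(E) = corank_{ℤ_p} Ш(E/K)[p^∞] = 0`** and `Ш(E/K)[p^∞]` is finite
(`Ш[p]` is finite, Silverman X.4.2(b)) — the isogeny door, proved without the corank calculus.
[cite: MilneADT2006, Ch. I Lemma 7.1(b) (proof), p. 96] [cite: SilvermanAEC2009, Thm. X.4.2(b)] -/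
theorem finite_and_shaCorank_eq_zero_of_degree_eq (φ : Isogeny W W') (p : ℕ) [hp : Fact p.Prime]
    (hdeg : φ.degree = p) (h' : W'.sha[(p : ℤ)] = ⊥) :
    Finite (AddCommGroup.primaryComponent W.sha p) ∧ W.shaCorank p = 0 := by
  have hfin : Finite (AddCommGroup.primaryComponent W.sha p) := by
    rw [primaryComponent_sha_eq_torsionBy_of_degree_eq φ p hdeg h']
    exact W.finite_sha_torsionBy_holds _ (by exact_mod_cast hp.out.ne_zero)
  exact ⟨hfin, (finite_primaryComponent_sha_iff_shaCorank_eq_zero W p).mp hfin⟩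

/-- Under the same hypotheses **`#Ш(E/K)[p^e] = #Ш(E/K)[p]` for every `e ≥ 1`**: the level profile of
`Ш(E/K)[p^∞]` is constant from the first level on. [cite: MilneADT2006, Ch. I Lemma 7.1(b) (proof), p. 96] -/
theorem natCard_sha_torsionBy_pow_eq_of_degree_eq (φ : Isogeny W W') (p : ℕ) (hdeg : φ.degree = p)
    (h' : W'.sha[(p : ℤ)] = ⊥) {e : ℕ} (he : 1 ≤ e) :
    Nat.card (W.sha[((p ^ e : ℕ) : ℤ)]) = Nat.card (W.sha[(p : ℤ)]) := by
  refine congrArg (fun H : AddSubgroup W.sha ↦ Nat.card H) (le_antisymm ?_ ?_)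
  · rw [← primaryComponent_sha_eq_torsionBy_of_degree_eq φ p hdeg h']
    exact fun x hx ↦ (AddCommGroup.mem_primaryComponent).mpr ⟨e, AddSubgroup.torsionBy.nsmul_iff.mp hx⟩
  · have h := torsionBy_pow_mono (X := W.sha) p he
    rwa [pow_one] at h

end Isogeny

end WeierstrassCurve

/-! ### §3 The complete `2`-primary components of the isogeny-door carriers -/

namespace Literature.NumberTheory.EllipticCurves

namespace ShaPrimaryIsogenyKill

open _root_.WeierstrassCurve

/-- `#Ш[2]` in the two currencies of the tree: `#(Ш ⊓ H¹[2]) = #(Ш[2])`. [cite: SilvermanAEC2009, X.§4] -/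
theorem natCard_sha_torsionBy_eq_natCard_inf (W : WeierstrassCurve ℚ) (n : ℕ) :
    Nat.card (W.sha[(n : ℤ)]) = Nat.card ↥(W.sha ⊓ AddSubgroup.torsionBy W.galH1 n) :=
  natCard_torsionBy_addSubgroup W.sha n

/-- **The kill packaged for a carrier in two-torsion normal form.** For `X = [0, a, 0, b, 0]` elliptic with
`X.twoIsogenyCodomain = X'`, `C • X' = Y`, `Ш(Y/ℚ)[2] = 0` (sharp descent on `Y`) and `#Ш(X/ℚ)[2] = 4`:
`Ш(X/ℚ)[2^∞] = Ш(X/ℚ)[2]`, it has `4` elements, `#Ш(X/ℚ)[2^e] = 4` for all `e ≥ 1`, and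
`Ш(X/ℚ)[2^∞] ≃+ ℤ/2 × ℤ/2`. [cite: MilneADT2006, Ch. I Lemma 7.1(b) (proof), p. 96]
[cite: SilvermanAEC2009, III.4.5 and Prop. X.6.5(b)] -/
theorem complete_two_primary_component (X X' Y : WeierstrassCurve ℚ) [X.IsTwoTorsionNF] [X.IsElliptic]
    [X'.IsElliptic] [Y.IsElliptic] (hX' : X.twoIsogenyCodomain = X') {C : VariableChange ℚ}
    (hC : C • X' = Y) (hY : ∀ c ∈ Y.sha, 2 • c = 0 → c = 0)
    (h4 : Nat.card ↥(X.sha ⊓ AddSubgroup.torsionBy X.galH1 2) = 4) :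
    AddCommGroup.primaryComponent X.sha 2 = X.sha[((2 : ℕ) : ℤ)] ∧
      Nat.card (AddCommGroup.primaryComponent X.sha 2) = 4 ∧
      (∀ e : ℕ, 1 ≤ e → Nat.card (X.sha[((2 ^ e : ℕ) : ℤ)]) = 4) ∧
      Nonempty (AddCommGroup.primaryComponent X.sha 2 ≃+ ZMod 2 × ZMod 2) := by
  haveI : Fact (Nat.Prime 2) := ⟨Nat.prime_two⟩
  haveI : X.twoIsogenyCodomain.IsElliptic := by rw [hX']; infer_instance
  have hbot : X.twoIsogenyCodomain.sha[((2 : ℕ) : ℤ)] = ⊥ := by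
    rw [hX']
    exact sha_torsionBy_eq_bot_of_smul_eq hC 2 (sha_torsionBy_eq_bot_of_forall Y 2 hY)
  have hdeg : (X.twoIsogeny).degree = 2 := degree_twoIsogeny X
  have hkill := Isogeny.primaryComponent_sha_eq_torsionBy_of_degree_eq X.twoIsogeny 2 hdeg hbot
  have h4' : Nat.card (X.sha[((2 : ℕ) : ℤ)]) = 4 := by
    rw [natCard_sha_torsionBy_eq_natCard_inf, Nat.cast_ofNat]; exact h4
  have hcardT : Nat.card (AddCommGroup.primaryComponent X.sha 2) = 4 := by
    rw [congrArg (fun H : AddSubgroup X.sha ↦ Nat.card H) hkill]; exact h4'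
  refine ⟨hkill, hcardT, fun e he ↦ ?_, ?_⟩
  · rw [Isogeny.natCard_sha_torsionBy_pow_eq_of_degree_eq X.twoIsogeny 2 hdeg hbot he]; exact h4'
  · refine nonempty_addEquiv_prod_zmod_of_natCard_eq_sq 2 (fun g ↦ ?_) (by rw [hcardT]; norm_num)
    have hg : (g : X.sha) ∈ X.sha[((2 : ℕ) : ℤ)] := hkill ▸ g.2
    exact Subtype.ext (by
      rw [AddSubgroupClass.coe_nsmul, ZeroMemClass.coe_zero]; exact AddSubgroup.torsionBy.nsmul_iff.mp hg)

/-- **`Ш(X₈/ℚ)[2^∞] = Ш(X₈/ℚ)[2] ≅ ℤ/2 × ℤ/2`** for the rank-`0` carrier `X₈ = [0,−8,0,1,0] : y² = x³ − 8x² + x`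
(`X₈ → X₈' = [0,16,0,60,0] ≅ Y = x(x−6)(x+4)`, `Ш(Y)[2] = 0`, `#Ш(X₈)[2] = 4`): the complete `2`-primary
component, `#Ш(X₈/ℚ)[2^e] = 4` for all `e ≥ 1`. [cite: SilvermanAEC2009, Prop. X.6.5(b) (the method)]
[cite: MilneADT2006, Ch. I Lemma 7.1(b) (proof), p. 96] -/
theorem X8_complete [(⟨0, -8, 0, 1, 0⟩ : WeierstrassCurve ℚ).IsElliptic] :
    AddCommGroup.primaryComponent (⟨0, -8, 0, 1, 0⟩ : WeierstrassCurve ℚ).sha 2 =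
        (⟨0, -8, 0, 1, 0⟩ : WeierstrassCurve ℚ).sha[((2 : ℕ) : ℤ)] ∧
      Nat.card (AddCommGroup.primaryComponent (⟨0, -8, 0, 1, 0⟩ : WeierstrassCurve ℚ).sha 2) = 4 ∧
      (∀ e : ℕ, 1 ≤ e → Nat.card ((⟨0, -8, 0, 1, 0⟩ : WeierstrassCurve ℚ).sha[((2 ^ e : ℕ) : ℤ)]) = 4) ∧
      Nonempty (AddCommGroup.primaryComponent (⟨0, -8, 0, 1, 0⟩ : WeierstrassCurve ℚ).sha 2 ≃+
        ZMod 2 × ZMod 2) := by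
  haveI := XCubeSub8XSqAddX.isElliptic_X'
  haveI := XCubeSub8XSqAddX.isElliptic_Y
  exact complete_two_primary_component _ _ _ XCubeSub8XSqAddX.twoIsogenyCodomain_X XCubeSub8XSqAddX.smul_X'_eq_Y
    XCubeSub8XSqAddX.forall_mem_sha_Y_two_smul_eq_zero ShaTwoTorsionExamples.natCard_sha_inf_torsionBy_two_X8

/-- **`Ш(X₁₂₁/ℚ)[2^∞] = Ш(X₁₂₁/ℚ)[2] ≅ ℤ/2 × ℤ/2`** for the rank-`1` carrier `X₁₂₁ = [0,8,0,121,0]`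
(`X₁₂₁ → [0,−16,0,−420,0] ≅ Y = x(x−14)(x−44)`, `Ш(Y)[2] = 0`, `#Ш(X₁₂₁)[2] = 4`); `#Ш(X₁₂₁/ℚ)[2^e] = 4` for all
`e ≥ 1`. [cite: SilvermanAEC2009, Prop. X.6.5(b) (the method)] [cite: MilneADT2006, Ch. I Lemma 7.1(b) (proof), p. 96] -/
theorem X121_complete [(⟨0, 8, 0, 121, 0⟩ : WeierstrassCurve ℚ).IsElliptic] :
    AddCommGroup.primaryComponent (⟨0, 8, 0, 121, 0⟩ : WeierstrassCurve ℚ).sha 2 =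
        (⟨0, 8, 0, 121, 0⟩ : WeierstrassCurve ℚ).sha[((2 : ℕ) : ℤ)] ∧
      Nat.card (AddCommGroup.primaryComponent (⟨0, 8, 0, 121, 0⟩ : WeierstrassCurve ℚ).sha 2) = 4 ∧
      (∀ e : ℕ, 1 ≤ e → Nat.card ((⟨0, 8, 0, 121, 0⟩ : WeierstrassCurve ℚ).sha[((2 ^ e : ℕ) : ℤ)]) = 4) ∧
      Nonempty (AddCommGroup.primaryComponent (⟨0, 8, 0, 121, 0⟩ : WeierstrassCurve ℚ).sha 2 ≃+
        ZMod 2 × ZMod 2) := by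
  haveI := Curve8x121.isElliptic_X'
  haveI := Curve8x121.isElliptic_Y
  exact complete_two_primary_component _ _ _ Curve8x121.twoIsogenyCodomain_X Curve8x121.smul_X'_eq_Y
    Curve8x121.forall_mem_sha_Y_two_smul_eq_zero Curve8x121.natCard_sha_inf_torsionBy_two

/-- **`Ш(X₃₄₆/ℚ)[2^∞] = Ш(X₃₄₆/ℚ)[2] ≅ ℤ/2 × ℤ/2` at rank `2`** for `X₃₄₆ = [0,−346,0,1369,0]`
(`X₃₄₆ → [0,692,0,114240,0] ≅ Y = x(x+37)(x−68)`, `Ш(Y)[2] = 0`, `#Ш(X₃₄₆)[2] = 4`); `#Ш(X₃₄₆/ℚ)[2^e] = 4` for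
all `e ≥ 1`. [cite: SilvermanAEC2009, Prop. X.6.5(b) (the method)] [cite: MilneADT2006, Ch. I Lemma 7.1(b) (proof), p. 96] -/
theorem X346_complete [(⟨0, -346, 0, 1369, 0⟩ : WeierstrassCurve ℚ).IsElliptic] :
    AddCommGroup.primaryComponent (⟨0, -346, 0, 1369, 0⟩ : WeierstrassCurve ℚ).sha 2 =
        (⟨0, -346, 0, 1369, 0⟩ : WeierstrassCurve ℚ).sha[((2 : ℕ) : ℤ)] ∧
      Nat.card (AddCommGroup.primaryComponent (⟨0, -346, 0, 1369, 0⟩ : WeierstrassCurve ℚ).sha 2) = 4 ∧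
      (∀ e : ℕ, 1 ≤ e →
        Nat.card ((⟨0, -346, 0, 1369, 0⟩ : WeierstrassCurve ℚ).sha[((2 ^ e : ℕ) : ℤ)]) = 4) ∧
      Nonempty (AddCommGroup.primaryComponent (⟨0, -346, 0, 1369, 0⟩ : WeierstrassCurve ℚ).sha 2 ≃+
        ZMod 2 × ZMod 2) := by
  haveI := Curve346.isElliptic_X'
  haveI := Curve346.isElliptic_Y
  exact complete_two_primary_component _ _ _ Curve346.twoIsogenyCodomain_X Curve346.smul_X'_eq_Y
    Curve346.forall_mem_sha_Y_two_smul_eq_zero ShaTwoTorsionExamples.natCard_sha_inf_torsionBy_two_X346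

/-- **`Ш(X₃₈₈/ℚ)[2^∞] = Ш(X₃₈₈/ℚ)[2] ≅ ℤ/2 × ℤ/2` at rank `2`** for `X₃₈₈ = [0,−388,0,676,0]`
(`X₃₈₈ → [0,776,0,147840,0] ≅ Y = [0,−58,0,−2184,0]`, `Ш(Y)[2] = 0`, `#Ш(X₃₈₈)[2] = 4`); `#Ш(X₃₈₈/ℚ)[2^e] = 4`
for all `e ≥ 1`. [cite: SilvermanAEC2009, Prop. X.6.5(b) (the method)] [cite: MilneADT2006, Ch. I Lemma 7.1(b) (proof), p. 96] -/
theorem X388_complete [(⟨0, -388, 0, 676, 0⟩ : WeierstrassCurve ℚ).IsElliptic] :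
    AddCommGroup.primaryComponent (⟨0, -388, 0, 676, 0⟩ : WeierstrassCurve ℚ).sha 2 =
        (⟨0, -388, 0, 676, 0⟩ : WeierstrassCurve ℚ).sha[((2 : ℕ) : ℤ)] ∧
      Nat.card (AddCommGroup.primaryComponent (⟨0, -388, 0, 676, 0⟩ : WeierstrassCurve ℚ).sha 2) = 4 ∧
      (∀ e : ℕ, 1 ≤ e →
        Nat.card ((⟨0, -388, 0, 676, 0⟩ : WeierstrassCurve ℚ).sha[((2 ^ e : ℕ) : ℤ)]) = 4) ∧
      Nonempty (AddCommGroup.primaryComponent (⟨0, -388, 0, 676, 0⟩ : WeierstrassCurve ℚ).sha 2 ≃+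
        ZMod 2 × ZMod 2) := by
  haveI := Curve388.isElliptic_X'
  haveI := Curve388.isElliptic_Y
  exact complete_two_primary_component _ _ _ Curve388.twoIsogenyCodomain_X Curve388.smul_X'_eq_Y
    Curve388.forall_mem_sha_Y_two_smul_eq_zero Curve388.natCard_sha_inf_torsionBy_two

end ShaPrimaryIsogenyKill

end Literature.NumberTheory.EllipticCurves

end
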